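import Mathlib.Geometry.Manifold.WhitneyEmbedding
import Mathlib.Analysis.Calculus.ContDiff.FiniteDimension
import Literature.Topology.FourManifolds.CircleNbhdOfFraming
import Literature.Topology.FourManifolds.NormalRetraction
import Literature.Topology.FourManifolds.KnotFraming
import Literature.Topology.FourManifolds.GeneralPositionSections
import Literature.Topology.FourManifolds.OrientationSign
import HarnessLib

/-!
# Normal framings of embedded circles in compact orientable 4-manifolds

Topic `Literature/Topology/FourManifolds`. This file proves the compact case of the named fact
`Literature.Topology.FourManifolds.exists_normalFraming_of_isOrientable` (`CircleNbhdOfFraming.lean`)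
— *the normal bundle of a smoothly embedded circle in an orientable 4-manifold is trivial* — and
deduces the compact case of `Literature.Topology.FourManifolds.nonempty_circleNbhd` (tubular
neighbourhoods `𝕊¹ × ℝ³ ↪ X`), which is the only input of
`Literature.Topology.FourManifolds.exists_isCircleSurgery` (`CircleSurgery.lean`) not yet in the
tree (`CircleSurgeryProofs.exists_isCircleSurgery_of`).

The classical argument (Hirsch, *Differential Topology* (1976), Ch. 4 §4, Lemma 4.1 and
Exercise 2: an orientable vector bundle over `S¹` is trivial; Kosinski, *Differential Manifolds*
(1993), VI.6: "the only orientable disc bundle over the circle is the product bundle") is carried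
out concretely, without vector bundles:

1. (**Setup**, `CircleSetup`.) Embed the compact manifold `X` in a Euclidean space `V` (Whitney,
   `exists_embedding_euclidean_of_compact`); the tangent spaces become the `4`-planes
   `T_x = de(T_x X) ⊆ V` with their smooth field of orthogonal projections
   (`NormalRetraction.lean`). Along the `1`-periodic curve `γ = c ∘ circlePt` the velocity `τ` is
   nowhere zero and the normal `3`-planes `ν_t = T_{γ t} ∩ τ(t)ᗮ` have a smooth periodic field of
   projections `Q t`.
2. (**Two normal fields by general position**, `GeneralPositionSections.lean`.) Constant vectors
   `w₁`, `w₂` off a Lebesgue-null set give smooth periodic sections `nᵢ t = Q t wᵢ` of `ν` which are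
   pointwise linearly independent.
3. (**The third normal field from the orientation**, `OrientationSign.lean`.) The orthogonal
   complement of `⟨τ, n₁, n₂⟩` in `T_{γ t}` is a line `L_t`; `n₃ t` is *the unit vector of `L_t`
   for which `(τ, n₁, n₂, n₃)` is positively oriented* (read back in `T_{γ t} X = ℝ⁴` through
   `(de)⁻¹`). It is smooth because the orientation character of a moving frame is locally
   constant, and periodic by construction. This is exactly where orientability is used.
4. (**Descent and assembly**.) The fields descend to `𝕊¹`; `N u = (de)⁻¹ ∘ (n₁, n₂, n₃)` is a
   normal framing in the sense of `exists_normalFraming_of_isOrientable` (`IsSmoothAlong`, and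
   `(dc_u) ⊕ N u` bijective), whence a tubular neighbourhood by
   `nonempty_circleNbhd_of_isSmoothAlong`.

## Main results

* `Literature.Topology.FourManifolds.exists_normalFraming_of_compactSpace`
* `Literature.Topology.FourManifolds.nonempty_circleNbhd_of_compactSpace`

## References

* M. W. Hirsch, *Differential Topology*, GTM 33 (1976), Ch. 4 §4, Lemma 4.1, Exercise 2;
  Ch. 4 §5 (tubular neighbourhoods via an embedding in `ℝⁿ`). [HirschDT1976]
* A. A. Kosinski, *Differential Manifolds* (1993), III Thm. 2.2, Cor. 2.3; VI.6. [Kosinski1993]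
* R. Gompf, A. Stipsicz, *4-Manifolds and Kirby Calculus* (1999), §5.2. [GompfStipsicz1999]
-/

open scoped Manifold ContDiff Topology
open Set Function Module Filter

noncomputable section

namespace Literature.Topology.FourManifolds

universe u

/-- Local notation: `𝔼 n` is the model Euclidean space `EuclideanSpace ℝ (Fin n)`. -/
local notation "𝔼 " n:arg => EuclideanSpace ℝ (Fin n)

/-- Local notation: `𝕊 n` is the unit sphere in `EuclideanSpace ℝ (Fin (n + 1))`. -/
local notation "𝕊 " n:arg => (Metric.sphere (0 : EuclideanSpace ℝ (Fin (n + 1))) 1)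

/-! ### Two lemmas on orthogonal projections -/

section Projections

variable {V : Type*} [NormedAddCommGroup V] [InnerProductSpace ℝ V] [FiniteDimensional ℝ V]

/-- **Relative orthogonal complements.** For subspaces `K ≤ K'` of a finite-dimensional inner
product space, the orthogonal projection onto `Kᗮ ⊓ K'` is the difference of the projections
onto `K'` and `K`. [folklore] -/
theorem starProjection_orthogonal_inf_of_le {K K' : Submodule ℝ V} (h : K ≤ K') :
    (Kᗮ ⊓ K').starProjection = K'.starProjection - K.starProjection := by
  ext v
  show (Kᗮ ⊓ K').starProjection v = K'.starProjection v - K.starProjection v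
  apply Submodule.eq_starProjection_of_mem_orthogonal
  · refine Submodule.mem_inf.2 ⟨?_, ?_⟩
    · rw [Submodule.mem_orthogonal]
      intro k hk
      rw [inner_sub_right, ← Submodule.inner_starProjection_left_eq_right,
        ← Submodule.inner_starProjection_left_eq_right,
        Submodule.starProjection_eq_self_iff.2 (h hk), Submodule.starProjection_eq_self_iff.2 hk,
        sub_self]
    · exact Submodule.sub_mem _ (Submodule.starProjection_apply_mem _ v)
        (h (Submodule.starProjection_apply_mem _ v))
  · rw [Submodule.mem_orthogonal]
    intro z hz
    obtain ⟨hzK, hzK'⟩ := Submodule.mem_inf.1 hz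
    have h1 : @inner ℝ V _ z (v - K'.starProjection v) = 0 := by
      rw [real_inner_comm]
      exact Submodule.starProjection_inner_eq_zero v z hzK'
    have h2 : @inner ℝ V _ z (K.starProjection v) = 0 := by
      rw [← Submodule.inner_starProjection_left_eq_right,
        (Submodule.starProjection_apply_eq_zero_iff (K := K)).2 hzK, inner_zero_left]
    rw [show v - (K'.starProjection v - K.starProjection v) =
      (v - K'.starProjection v) + K.starProjection v by abel, inner_add_right, h1, h2, add_zero]

/-- The **projection onto the line through `w`** as an explicit continuous linear map,
`v ↦ ‖w‖⁻² ⟪w, v⟫ w` (smooth in `w ≠ 0`). [folklore] -/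
def lineProj (w : V) : V →L[ℝ] V := (‖w‖ ^ 2)⁻¹ • (innerSL ℝ w).smulRight w

omit [FiniteDimensional ℝ V] in
/-- Unfolding of `lineProj`. [folklore] -/
theorem lineProj_apply (w v : V) : lineProj w v = ((‖w‖ ^ 2)⁻¹ * @inner ℝ V _ w v) • w := by
  simp [lineProj, mul_smul]

omit [FiniteDimensional ℝ V] in
/-- `lineProj w` is the orthogonal projection onto `ℝ ∙ w`. [folklore] -/
theorem lineProj_eq_starProjection (w : V) : lineProj w = (ℝ ∙ w).starProjection := by
  ext v
  rw [lineProj_apply, Submodule.starProjection_singleton, div_eq_inv_mul]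
  norm_cast

omit [FiniteDimensional ℝ V] in
/-- `w ↦ lineProj w` is smooth away from `0`. [folklore] -/
theorem contDiffAt_lineProj {w : V} (hw : w ≠ 0) : ContDiffAt ℝ ∞ (lineProj : V → V →L[ℝ] V) w := by
  have h1 : ContDiffAt ℝ ∞ (fun w : V => (‖w‖ ^ 2)⁻¹) w := by
    refine ((contDiffAt_id.norm_sq ℝ)).inv ?_
    exact pow_ne_zero 2 (norm_ne_zero_iff.2 hw)
  have h2 : ContDiff ℝ ∞ fun w : V => (innerSL ℝ w).smulRight w :=
    ((ContinuousLinearMap.smulRightL ℝ V V).contDiff.comp (innerSL ℝ).contDiff).clm_apply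
      contDiff_id
  exact h1.smul h2.contDiffAt

end Projections

/-! ### A left inverse for injective linear maps -/

section LeftInv

variable {E V : Type*} [NormedAddCommGroup E] [InnerProductSpace ℝ E] [FiniteDimensional ℝ E]
  [NormedAddCommGroup V] [InnerProductSpace ℝ V] [FiniteDimensional ℝ V]

/-- The **pseudo-inverse** `(A†A)⁻¹A† : V →L E` of `A : E →L V`: a left inverse of an injective
`A`, vanishing on `(range A)ᗮ`. [folklore] -/
def leftInv (A : E →L[ℝ] V) : V →L[ℝ] E := (gramOp A).inverse.comp (ContinuousLinearMap.adjoint A)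

/-- `leftInv A` is a left inverse of an injective `A`. [folklore] -/
theorem leftInv_apply_self {A : E →L[ℝ] V} (hA : Injective A) (u : E) : leftInv A (A u) = u := by
  rw [leftInv, ContinuousLinearMap.comp_apply, ← gramOp_apply,
    (isInvertible_gramOp hA).inverse_apply_self]

/-- `A ∘ leftInv A` is the orthogonal projection onto the range (`gramProj`). [folklore] -/
theorem self_leftInv_apply (A : E →L[ℝ] V) (v : V) : A (leftInv A v) = gramProj A v := rfl

/-- On the range of an injective `A`, `leftInv A` inverts `A`. [folklore] -/
theorem apply_leftInv_of_mem_range {A : E →L[ℝ] V} (hA : Injective A) {v : V}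
    (hv : v ∈ LinearMap.range A.toLinearMap) : A (leftInv A v) = v := by
  obtain ⟨u, rfl⟩ := hv
  change A (leftInv A (A u)) = A u
  rw [leftInv_apply_self hA]

/-- `leftInv A` is injective on the range of an injective `A`. [folklore] -/
theorem leftInv_injOn {A : E →L[ℝ] V} (hA : Injective A) :
    InjOn (leftInv A) (LinearMap.range A.toLinearMap) := by
  intro v hv w hw h
  rw [← apply_leftInv_of_mem_range hA hv, ← apply_leftInv_of_mem_range hA hw, h]

/-- **`A ↦ leftInv A` is smooth at injective `A`.** [folklore] -/
theorem contDiffAt_leftInv {A : E →L[ℝ] V} (hA : Injective A) :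
    ContDiffAt ℝ ∞ (leftInv : (E →L[ℝ] V) → V →L[ℝ] E) A := by
  have h1 : ContDiffAt ℝ ∞ (fun B : E →L[ℝ] V => ContinuousLinearMap.adjoint B) A :=
    (adjointL : (E →L[ℝ] V) →L[ℝ] (V →L[ℝ] E)).contDiff.contDiffAt
  have h2 : ContDiffAt ℝ ∞ (fun B : E →L[ℝ] V => (gramOp B).inverse) A :=
    (isInvertible_gramOp hA).contDiffAt_map_inverse.comp A contDiff_gramOp.contDiffAt
  exact h2.clm_comp h1

end LeftInv

/-! ### Assembling vectors into linear maps `ℝ³ → V` -/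

section FrameOf

variable {V : Type*} [NormedAddCommGroup V] [NormedSpace ℝ V]

/-- **Assembling three vectors into a linear map `ℝ³ → V`**, as a continuous linear map in the
triple. [folklore] -/
def frameOfL : (Fin 3 → V) →L[ℝ] (𝔼 3 →L[ℝ] V) :=
  ∑ i : Fin 3, (ContinuousLinearMap.smulRightL ℝ (𝔼 3) V (EuclideanSpace.proj i)).comp
    (ContinuousLinearMap.proj i)

/-- Unfolding of `frameOfL`. [folklore] -/
theorem frameOfL_apply (F : Fin 3 → V) (a : 𝔼 3) : frameOfL F a = ∑ i : Fin 3, a i • F i := by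
  simp [frameOfL]

end FrameOf

/-! ### The setup: an embedded circle in a manifold embedded in Euclidean space -/

/-- **Setup for the framing construction.** A `C^∞` map `e : X → V` of the 4-manifold `X` into a
finite-dimensional inner product space with injective differential (a Whitney embedding, in the
application) and a `C^∞` embedding `c : 𝕊¹ → X` (Hirsch, *Differential Topology* (1976), Ch. 4 §5:
tubular neighbourhoods of `M ⊆ X` are built inside `X ⊆ ℝⁿ`). [folklore] -/
structure CircleSetup (X : Type*) [TopologicalSpace X] [ChartedSpace (𝔼 4) X]
    (V : Type*) [NormedAddCommGroup V] [InnerProductSpace ℝ V] where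
  /-- The map into Euclidean space. -/
  e : X → V
  /-- The embedded circle. -/
  c : 𝕊 1 → X
  /-- `e` is smooth. -/
  contMDiff_e : ContMDiff (𝓡 4) 𝓘(ℝ, V) ∞ e
  /-- `e` has injective differential. -/
  injective_mfderiv_e : ∀ x, Injective (mfderiv (𝓡 4) 𝓘(ℝ, V) e x)
  /-- `c` is a smooth embedding. -/
  isSmoothEmbedding_c : Manifold.IsSmoothEmbedding (𝓡 1) (𝓡 4) ∞ c

namespace CircleSetup

variable {X : Type*} [TopologicalSpace X] [ChartedSpace (𝔼 4) X]
  {V : Type*} [NormedAddCommGroup V] [InnerProductSpace ℝ V] (D : CircleSetup X V)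

/-! #### The curve, its velocity and the tangent `4`-planes -/

/-- The `1`-periodic parametrisation `γ = c ∘ circlePt : ℝ → X` of the circle. [folklore] -/
def curve (t : ℝ) : X := D.c (circlePt t)

/-- The curve in Euclidean space, `e ∘ γ`. [folklore] -/
def pos (t : ℝ) : V := D.e (D.curve t)

/-- The velocity `(e ∘ γ)'` of the curve in Euclidean space. [folklore] -/
def vel (t : ℝ) : V := deriv D.pos t

/-- The differential `de_x : T_x X = ℝ⁴ → V` (an injective linear map onto the tangent plane
`T_x ⊆ V`). [folklore] -/
def tmap (x : X) : 𝔼 4 →L[ℝ] V := mfderiv (𝓡 4) 𝓘(ℝ, V) D.e x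

/-- The tangent `4`-plane `T_x = de(T_x X) ⊆ V`. [folklore] -/
abbrev tplane (x : X) : Submodule ℝ V := tangentPlane (𝓡 4) D.e x

/-- `c` is smooth. [folklore] -/
theorem contMDiff_c : ContMDiff (𝓡 1) (𝓡 4) ∞ D.c := D.isSmoothEmbedding_c.contMDiff

/-- The curve `γ` is smooth. [folklore] -/
theorem contMDiff_curve : ContMDiff 𝓘(ℝ, ℝ) (𝓡 4) ∞ D.curve :=
  D.contMDiff_c.comp contMDiff_circlePt

/-- The curve `γ` is continuous. [folklore] -/
theorem continuous_curve : Continuous D.curve := D.contMDiff_curve.continuous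

/-- The curve `γ` has period `1`. [folklore] -/
theorem periodic_curve : Periodic D.curve 1 := fun t => by
  simp only [curve, circlePt_add_one]

/-- `e ∘ γ` is smooth. [folklore] -/
theorem contDiff_pos : ContDiff ℝ ∞ D.pos :=
  contMDiff_iff_contDiff.1 (D.contMDiff_e.comp D.contMDiff_curve)

/-- `e ∘ γ` has period `1`. [folklore] -/
theorem periodic_pos : Periodic D.pos 1 := fun t => by
  simp only [pos, D.periodic_curve t]

/-- The velocity is smooth. [folklore] -/
theorem contDiff_vel : ContDiff ℝ ∞ D.vel := (contDiff_infty_iff_deriv.1 D.contDiff_pos).2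

/-- The velocity has period `1`. [folklore] -/
theorem periodic_vel : Periodic D.vel 1 := Function.Periodic.deriv D.periodic_pos

/-- `e` is differentiable. [folklore] -/
theorem mdifferentiableAt_e (x : X) : MDifferentiableAt (𝓡 4) 𝓘(ℝ, V) D.e x :=
  D.contMDiff_e.contMDiffAt.mdifferentiableAt (by simp)

/-- `γ` is differentiable. [folklore] -/
theorem mdifferentiableAt_curve (t : ℝ) : MDifferentiableAt 𝓘(ℝ, ℝ) (𝓡 4) D.curve t :=
  D.contMDiff_curve.contMDiffAt.mdifferentiableAt (by simp)

/-- **Chain rule for the velocity**: `(e ∘ γ)'(t) = de_{γ t} (γ'(t))`. [folklore] -/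
theorem vel_eq (t : ℝ) :
    D.vel t = D.tmap (D.curve t) (mfderiv 𝓘(ℝ, ℝ) (𝓡 4) D.curve t (1 : ℝ)) := by
  have h : mfderiv 𝓘(ℝ, ℝ) 𝓘(ℝ, V) D.pos t =
      (D.tmap (D.curve t)).comp (mfderiv 𝓘(ℝ, ℝ) (𝓡 4) D.curve t) :=
    mfderiv_comp t (D.mdifferentiableAt_e _) (D.mdifferentiableAt_curve t)
  rw [vel, ← fderiv_apply_one_eq_deriv, ← mfderiv_eq_fderiv, h]
  rfl

/-- The velocity is a tangent vector: `τ t ∈ T_{γ t}`. [folklore] -/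
theorem vel_mem_tplane (t : ℝ) : D.vel t ∈ D.tplane (D.curve t) := by
  rw [D.vel_eq t]
  exact mfderiv_mem_tangentPlane _ _ _

/-- The tangent planes are `4`-dimensional. [folklore] -/
theorem finrank_tplane (x : X) : finrank ℝ (D.tplane x) = 4 := by
  have h : finrank ℝ (D.tplane x) = finrank ℝ (𝔼 4) :=
    LinearMap.finrank_range_of_inj (f := (mfderiv (𝓡 4) 𝓘(ℝ, V) D.e x).toLinearMap)
      (D.injective_mfderiv_e x)
  rw [h, finrank_euclideanSpace_fin]

/-- The **normal `3`-plane** `ν_t = T_{γ t} ∩ τ(t)ᗮ` of the curve inside the tangent plane.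
[folklore] -/
def nplane (t : ℝ) : Submodule ℝ V := (ℝ ∙ D.vel t)ᗮ ⊓ D.tplane (D.curve t)

/-- The normal planes lie in the tangent planes. [folklore] -/
theorem nplane_le (t : ℝ) : D.nplane t ≤ D.tplane (D.curve t) := inf_le_right

/-- Normal vectors are orthogonal to the velocity. [folklore] -/
theorem inner_vel_of_mem_nplane {t : ℝ} {v : V} (hv : v ∈ D.nplane t) :
    @inner ℝ V _ (D.vel t) v = 0 :=
  (Submodule.mem_orthogonal_singleton_iff_inner_right).1 (Submodule.mem_inf.1 hv).1

variable [IsManifold (𝓡 4) ∞ X]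

/-- The differential of `c` is injective (`c` is an immersion). [folklore] -/
theorem injective_mfderiv_c (u : 𝕊 1) : Injective (mfderiv (𝓡 1) (𝓡 4) D.c u) := by
  obtain ⟨F, _, _, hF⟩ := D.isSmoothEmbedding_c.isImmersion
  exact Manifold.IsImmersionAtOfComplement.mfderiv_injective (hF u) (by simp)

/-- The differential of the curve `γ = c ∘ circlePt` is injective. [folklore] -/
theorem injective_mfderiv_curve (t : ℝ) : Injective (mfderiv 𝓘(ℝ, ℝ) (𝓡 4) D.curve t) := by
  have hc : MDifferentiableAt (𝓡 1) (𝓡 4) D.c (circlePt t) :=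
    D.contMDiff_c.contMDiffAt.mdifferentiableAt (by simp)
  have hp : MDifferentiableAt 𝓘(ℝ, ℝ) (𝓡 1) circlePt t :=
    contMDiff_circlePt.contMDiffAt.mdifferentiableAt (by simp)
  rw [show D.curve = D.c ∘ circlePt from rfl, mfderiv_comp t hc hp]
  exact (D.injective_mfderiv_c _).comp (mfderiv_circlePt_injective t)

/-- **The curve is regular**: `(e ∘ γ)' ≠ 0` (three injective differentials). [folklore] -/
theorem vel_ne_zero (t : ℝ) : D.vel t ≠ 0 := by
  rw [D.vel_eq t]
  intro h
  have h1 : mfderiv 𝓘(ℝ, ℝ) (𝓡 4) D.curve t (1 : ℝ) = 0 :=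
    D.injective_mfderiv_e _ (h.trans (map_zero _).symm)
  have h2 : (1 : ℝ) = 0 := D.injective_mfderiv_curve t (h1.trans (map_zero _).symm)
  exact one_ne_zero h2

variable [FiniteDimensional ℝ V]

/-- The field of tangent projections along the curve is smooth. [folklore] -/
theorem contDiff_tproj_curve : ContDiff ℝ ∞ fun t => tangentProj (𝓡 4) D.e (D.curve t) :=
  contMDiff_iff_contDiff.1
    ((contMDiff_tangentProj D.contMDiff_e D.injective_mfderiv_e).comp D.contMDiff_curve)

/-! #### The normal `3`-planes along the curve -/

/-- The **field of orthogonal projections onto the normal `3`-planes**, `Q t = P_{γ t} - proj_τ`.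
[folklore] -/
def nproj (t : ℝ) : V →L[ℝ] V := tangentProj (𝓡 4) D.e (D.curve t) - lineProj (D.vel t)

omit [IsManifold (𝓡 4) ∞ X] in
/-- `Q t` is the orthogonal projection onto `ν_t`. [folklore] -/
theorem starProjection_nplane (t : ℝ) : (D.nplane t).starProjection = D.nproj t := by
  rw [nplane, starProjection_orthogonal_inf_of_le
    ((Submodule.span_singleton_le_iff_mem _ _).2 (D.vel_mem_tplane t)), nproj,
    lineProj_eq_starProjection]
  rfl

/-- The normal planes are `3`-dimensional. [folklore] -/
theorem finrank_nplane (t : ℝ) : finrank ℝ (D.nplane t) = 3 := by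
  have hle : (ℝ ∙ D.vel t) ≤ D.tplane (D.curve t) :=
    (Submodule.span_singleton_le_iff_mem _ _).2 (D.vel_mem_tplane t)
  have h := Submodule.finrank_add_inf_finrank_orthogonal hle
  rw [finrank_span_singleton (D.vel_ne_zero t), D.finrank_tplane] at h
  rw [nplane]
  omega

/-- The field `Q` is smooth. [folklore] -/
theorem contDiff_nproj : ContDiff ℝ ∞ D.nproj :=
  D.contDiff_tproj_curve.sub (contDiff_iff_contDiffAt.2 fun t =>
    (contDiffAt_lineProj (D.vel_ne_zero t)).comp t D.contDiff_vel.contDiffAt)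

omit [IsManifold (𝓡 4) ∞ X] in
/-- The field `Q` has period `1`. [folklore] -/
theorem periodic_nproj : Periodic D.nproj 1 := fun t => by
  simp only [nproj, D.periodic_curve t, D.periodic_vel t]

omit [IsManifold (𝓡 4) ∞ X] in
/-- Values of `Q t` lie in `ν_t`. [folklore] -/
theorem nproj_apply_mem (t : ℝ) (v : V) : D.nproj t v ∈ D.nplane t := by
  rw [← D.starProjection_nplane t]
  exact Submodule.starProjection_apply_mem _ v

/-! #### Two normal fields by general position -/

/-- **Two independent normal fields exist** (general position, `exists_two_sections`). [folklore] -/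
theorem exists_two_normal_vectors :
    ∃ w : V × V, (∀ t, D.nproj t w.1 ≠ 0) ∧ ∀ (t : ℝ) (r : ℝ), D.nproj t w.2 ≠ r • D.nproj t w.1 := by
  obtain ⟨w₁, w₂, h1, h2⟩ := exists_two_sections D.starProjection_nplane D.finrank_nplane
    (D.contDiff_nproj.differentiable (by simp)) D.periodic_nproj
  exact ⟨(w₁, w₂), h1, h2⟩

/-- The chosen pair of constant vectors in general position. [folklore] -/
def wpair : V × V := D.exists_two_normal_vectors.choose

/-- The **first normal field** `n₁ t = Q t w₁`. [folklore] -/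
def sec1 (t : ℝ) : V := D.nproj t D.wpair.1

/-- The **second normal field** `n₂ t = Q t w₂`. [folklore] -/
def sec2 (t : ℝ) : V := D.nproj t D.wpair.2

/-- `n₁` never vanishes. [folklore] -/
theorem sec1_ne_zero (t : ℝ) : D.sec1 t ≠ 0 := D.exists_two_normal_vectors.choose_spec.1 t

/-- `n₂` is never a multiple of `n₁`. [folklore] -/
theorem sec2_ne_smul (t : ℝ) (r : ℝ) : D.sec2 t ≠ r • D.sec1 t :=
  D.exists_two_normal_vectors.choose_spec.2 t r

/-- `n₁` is smooth. [folklore] -/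
theorem contDiff_sec1 : ContDiff ℝ ∞ D.sec1 := D.contDiff_nproj.clm_apply contDiff_const

/-- `n₂` is smooth. [folklore] -/
theorem contDiff_sec2 : ContDiff ℝ ∞ D.sec2 := D.contDiff_nproj.clm_apply contDiff_const

/-- `n₁` has period `1`. [folklore] -/
theorem periodic_sec1 : Periodic D.sec1 1 := fun t => by simp only [sec1, D.periodic_nproj t]

/-- `n₂` has period `1`. [folklore] -/
theorem periodic_sec2 : Periodic D.sec2 1 := fun t => by simp only [sec2, D.periodic_nproj t]

/-- `n₁ t ∈ ν_t`. [folklore] -/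
theorem sec1_mem (t : ℝ) : D.sec1 t ∈ D.nplane t := D.nproj_apply_mem t _

/-- `n₂ t ∈ ν_t`. [folklore] -/
theorem sec2_mem (t : ℝ) : D.sec2 t ∈ D.nplane t := D.nproj_apply_mem t _

/-- The **three fields `τ, n₁, n₂`** as a frame `Fin 3 → V`. [folklore] -/
def frame3 (t : ℝ) : Fin 3 → V := ![D.vel t, D.sec1 t, D.sec2 t]

/-- `τ, n₁, n₂` are linearly independent. [folklore] -/
theorem linearIndependent_frame3 (t : ℝ) : LinearIndependent ℝ (D.frame3 t) := by
  rw [Fintype.linearIndependent_iff]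
  intro g hg
  simp only [frame3, Fin.sum_univ_three, Matrix.cons_val_zero, Matrix.cons_val_one,
    Matrix.cons_val] at hg
  -- pair with `τ`: the normal fields are orthogonal to it
  have h0 : g 0 = 0 := by
    have := congrArg (fun v => @inner ℝ V _ (D.vel t) v) hg
    simp only [inner_add_right, inner_smul_right, D.inner_vel_of_mem_nplane (D.sec1_mem t),
      D.inner_vel_of_mem_nplane (D.sec2_mem t), mul_zero, add_zero, inner_zero_right,
      real_inner_self_eq_norm_sq] at this
    exact (mul_eq_zero.1 this).resolve_right (pow_ne_zero 2 (norm_ne_zero_iff.2 (D.vel_ne_zero t)))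
  rw [h0, zero_smul, zero_add] at hg
  have h2 : g 2 = 0 := by
    by_contra hne
    apply D.sec2_ne_smul t ((g 2)⁻¹ * -g 1)
    calc D.sec2 t = (g 2)⁻¹ • (g 2 • D.sec2 t) := by rw [smul_smul, inv_mul_cancel₀ hne, one_smul]
      _ = (g 2)⁻¹ • (-(g 1 • D.sec1 t)) := by rw [eq_neg_of_add_eq_zero_right hg]
      _ = ((g 2)⁻¹ * -g 1) • D.sec1 t := by rw [← neg_smul, smul_smul]
  rw [h2, zero_smul, add_zero] at hg
  have h1 : g 1 = 0 := (smul_eq_zero.1 hg).resolve_right (D.sec1_ne_zero t)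
  intro i
  fin_cases i <;> assumption

/-- The frame `τ, n₁, n₂` lies in the tangent plane. [folklore] -/
theorem frame3_mem (t : ℝ) (i : Fin 3) : D.frame3 t i ∈ D.tplane (D.curve t) := by
  fin_cases i
  · exact D.vel_mem_tplane t
  · exact D.nplane_le t (D.sec1_mem t)
  · exact D.nplane_le t (D.sec2_mem t)

/-- Each field of the frame is smooth. [folklore] -/
theorem contDiff_frame3 (i : Fin 3) : ContDiff ℝ ∞ fun t => D.frame3 t i := by
  fin_cases i
  · exact D.contDiff_vel
  · exact D.contDiff_sec1
  · exact D.contDiff_sec2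

/-- The frame has period `1`. [folklore] -/
theorem periodic_frame3 : Periodic D.frame3 1 := fun t => by
  simp only [frame3, D.periodic_vel t, D.periodic_sec1 t, D.periodic_sec2 t]

/-! #### The line `L_t = T_{γ t} ∩ ⟨τ, n₁, n₂⟩ᗮ` -/

/-- The frame as a linear map `ℝ³ → V`, `a ↦ ∑ aᵢ • (τ, n₁, n₂)ᵢ`. [folklore] -/
def frameMap (t : ℝ) : 𝔼 3 →L[ℝ] V :=
  ∑ i : Fin 3, (EuclideanSpace.proj i : 𝔼 3 →L[ℝ] ℝ).smulRight (D.frame3 t i)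

/-- Unfolding of `frameMap`. [folklore] -/
theorem frameMap_apply (t : ℝ) (a : 𝔼 3) : D.frameMap t a = ∑ i : Fin 3, a i • D.frame3 t i := by
  simp [frameMap]

/-- `frameMap t` is injective. [folklore] -/
theorem injective_frameMap (t : ℝ) : Injective (D.frameMap t) := by
  refine (injective_iff_map_eq_zero _).2 fun a ha => ?_
  rw [frameMap_apply] at ha
  have := Fintype.linearIndependent_iff.1 (D.linearIndependent_frame3 t) (fun i => a i) ha
  ext i
  exact this i

/-- The range of `frameMap t` is spanned by tangent vectors. [folklore] -/
theorem range_frameMap_le (t : ℝ) :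
    LinearMap.range (D.frameMap t).toLinearMap ≤ D.tplane (D.curve t) := by
  rintro _ ⟨a, rfl⟩
  change D.frameMap t a ∈ _
  rw [frameMap_apply]
  exact Submodule.sum_mem _ fun i _ => Submodule.smul_mem _ _ (D.frame3_mem t i)

/-- `frameMap` is smooth in `t`. [folklore] -/
theorem contDiff_frameMap : ContDiff ℝ ∞ D.frameMap := by
  refine contDiff_clm_apply_iff.2 fun a => ?_
  simp only [frameMap_apply]
  exact ContDiff.sum fun i _ => contDiff_const.smul (D.contDiff_frame3 i)

/-- `frameMap` has period `1`. [folklore] -/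
theorem periodic_frameMap : Periodic D.frameMap 1 := fun t => by
  simp only [frameMap, D.periodic_frame3 t]

/-- The **line** `L_t = T_{γ t} ∩ ⟨τ t, n₁ t, n₂ t⟩ᗮ`, home of the third normal field. [folklore] -/
def nline (t : ℝ) : Submodule ℝ V :=
  (LinearMap.range (D.frameMap t).toLinearMap)ᗮ ⊓ D.tplane (D.curve t)

/-- The **field of orthogonal projections onto the lines `L_t`**, `P_{γ t} - proj_{⟨τ, n₁, n₂⟩}`,
with the second projection given by the Gram formula. [folklore] -/
def lproj (t : ℝ) : V →L[ℝ] V := tangentProj (𝓡 4) D.e (D.curve t) - gramProj (D.frameMap t)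

/-- `lproj t` is the orthogonal projection onto `L_t`. [folklore] -/
theorem starProjection_nline (t : ℝ) : (D.nline t).starProjection = D.lproj t := by
  rw [nline, starProjection_orthogonal_inf_of_le (D.range_frameMap_le t), lproj,
    gramProj_eq_starProjection (D.injective_frameMap t)]
  rfl

/-- The lines `L_t` are `1`-dimensional. [folklore] -/
theorem finrank_nline (t : ℝ) : finrank ℝ (D.nline t) = 1 := by
  have h := Submodule.finrank_add_inf_finrank_orthogonal (D.range_frameMap_le t)
  rw [LinearMap.finrank_range_of_inj (D.injective_frameMap t), finrank_euclideanSpace_fin,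
    D.finrank_tplane] at h
  rw [nline]
  omega

/-- The field `lproj` is smooth. [folklore] -/
theorem contDiff_lproj : ContDiff ℝ ∞ D.lproj :=
  D.contDiff_tproj_curve.sub (contDiff_iff_contDiffAt.2 fun t =>
    (contDiffAt_gramProj (D.injective_frameMap t)).comp t D.contDiff_frameMap.contDiffAt)

/-- The field `lproj` has period `1`. [folklore] -/
theorem periodic_lproj : Periodic D.lproj 1 := fun t => by
  simp only [lproj, D.periodic_curve t, D.periodic_frameMap t]

/-- The lines lie in the tangent planes. [folklore] -/
theorem nline_le (t : ℝ) : D.nline t ≤ D.tplane (D.curve t) := inf_le_right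

/-- Vectors of `L_t` are orthogonal to `τ, n₁, n₂`. [folklore] -/
theorem inner_frame3_of_mem_nline {t : ℝ} {v : V} (hv : v ∈ D.nline t) (i : Fin 3) :
    @inner ℝ V _ (D.frame3 t i) v = 0 := by
  have h := (Submodule.mem_inf.1 hv).1
  rw [Submodule.mem_orthogonal] at h
  refine h _ ⟨EuclideanSpace.single i 1, ?_⟩
  change D.frameMap t (EuclideanSpace.single i 1) = _
  rw [frameMap_apply, Finset.sum_eq_single i]
  · simp
  · intro j _ hj
    simp [hj]
  · simp

/-- **The full frame is linearly independent**: `τ, n₁, n₂` together with any non-zero vector of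
`L_t`. [folklore] -/
theorem linearIndependent_vframe {t : ℝ} {v : V} (hv : v ∈ D.nline t) (hv0 : v ≠ 0) :
    LinearIndependent ℝ ![D.vel t, D.sec1 t, D.sec2 t, v] := by
  rw [Fintype.linearIndependent_iff]
  intro g hg
  simp only [Fin.sum_univ_four, Matrix.cons_val_zero, Matrix.cons_val_one, Matrix.cons_val] at hg
  -- pair with `v`
  have h3 : g 3 = 0 := by
    have := congrArg (fun w => @inner ℝ V _ w v) hg
    simp only [inner_add_left, inner_smul_left, inner_zero_left, RCLike.conj_to_real] at this
    have e0 := D.inner_frame3_of_mem_nline hv 0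
    have e1 := D.inner_frame3_of_mem_nline hv 1
    have e2 := D.inner_frame3_of_mem_nline hv 2
    simp only [frame3, Matrix.cons_val_zero, Matrix.cons_val_one, Matrix.cons_val] at e0 e1 e2
    rw [e0, e1, e2, mul_zero, mul_zero, mul_zero, zero_add, zero_add, zero_add,
      real_inner_self_eq_norm_sq] at this
    exact (mul_eq_zero.1 this).resolve_right (pow_ne_zero 2 (norm_ne_zero_iff.2 hv0))
  rw [h3, zero_smul, add_zero] at hg
  have h012 := Fintype.linearIndependent_iff.1 (D.linearIndependent_frame3 t) ![g 0, g 1, g 2]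
    (by simpa [frame3, Fin.sum_univ_three] using hg)
  intro i
  fin_cases i
  · exact h012 0
  · exact h012 1
  · exact h012 2
  · exact h3

/-! #### The third normal field from the orientation -/

/-- The reindexing `Fin (finrank ℝ ℝ⁴) ≃ Fin 4` used to feed frames of `T_x X = ℝ⁴` to
`SmoothOrientation.IsPosFrame`. [folklore] -/
def idx : Fin (finrank ℝ (𝔼 4)) ≃ Fin 4 := finCongr finrank_euclideanSpace_fin

/-- The frame `(τ t, n₁ t, n₂ t, v)` of `T_{γ t} ⊆ V` with a variable fourth vector `v`. [folklore] -/
def vframe (t : ℝ) (v : V) : Fin 4 → V := ![D.vel t, D.sec1 t, D.sec2 t, v]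

/-- The frame `(τ t, n₁ t, n₂ t, v)` read back in `T_{γ t} X = ℝ⁴` through the left inverse of
`de_{γ t}` (and reindexed by `idx`). [folklore] -/
def eframe (t : ℝ) (v : V) : Fin (finrank ℝ (𝔼 4)) → 𝔼 4 :=
  fun i => leftInv (D.tmap (D.curve t)) (D.vframe t v (idx i))

/-- The first three vectors of `vframe` do not depend on `v`. [folklore] -/
theorem vframe_apply_of_ne_three (t : ℝ) (v w : V) {k : Fin 4} (hk : k ≠ 3) :
    D.vframe t v k = D.vframe t w k := by
  fin_cases k <;> simp [vframe] at hk ⊢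

/-- The last vector of `vframe t v` is `v`. [folklore] -/
@[simp] theorem vframe_apply_three (t : ℝ) (v : V) : D.vframe t v 3 = v := rfl

/-- The vectors of `vframe t v` are tangent vectors when `v` is. [folklore] -/
theorem vframe_mem (t : ℝ) {v : V} (hv : v ∈ D.tplane (D.curve t)) (k : Fin 4) :
    D.vframe t v k ∈ D.tplane (D.curve t) := by
  fin_cases k
  · exact D.vel_mem_tplane t
  · exact D.nplane_le t (D.sec1_mem t)
  · exact D.nplane_le t (D.sec2_mem t)
  · exact hv

/-- `vframe` is continuous in `t` along a continuous fourth vector. [folklore] -/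
theorem continuousOn_vframe {S : Set ℝ} {v : ℝ → V} (hv : ContinuousOn v S) (k : Fin 4) :
    ContinuousOn (fun t => D.vframe t (v t) k) S := by
  fin_cases k
  · exact D.contDiff_vel.continuous.continuousOn
  · exact D.contDiff_sec1.continuous.continuousOn
  · exact D.contDiff_sec2.continuous.continuousOn
  · exact hv

/-- `vframe` has period `1` in `t`. [folklore] -/
theorem vframe_add_one (t : ℝ) (v : V) : D.vframe (t + 1) v = D.vframe t v := by
  simp only [vframe, D.periodic_vel t, D.periodic_sec1 t, D.periodic_sec2 t]

/-- `eframe` has period `1` in `t`. [folklore] -/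
theorem eframe_add_one (t : ℝ) (v : V) : D.eframe (t + 1) v = D.eframe t v := by
  funext i
  simp only [eframe, D.vframe_add_one, D.periodic_curve t]

/-- **The full frame of `V`-vectors is linearly independent** for a non-zero `v ∈ L_t`. [folklore] -/
theorem linearIndependent_vframe' {t : ℝ} {v : V} (hv : v ∈ D.nline t) (hv0 : v ≠ 0) :
    LinearIndependent ℝ (D.vframe t v) :=
  D.linearIndependent_vframe hv hv0

omit [IsManifold (𝓡 4) ∞ X] [FiniteDimensional ℝ V] in
/-- Membership in the tangent plane, with the preimage typed in `ℝ⁴`. [folklore] -/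
theorem mem_tplane_iff {x : X} {z : V} : z ∈ D.tplane x ↔ ∃ a : 𝔼 4, D.tmap x a = z := Iff.rfl

/-- **The pulled-back frame is non-degenerate** for a non-zero `v ∈ L_t`: `leftInv (de)` is
injective on the tangent plane, which contains the whole frame. [folklore] -/
theorem det_eframe_ne_zero {t : ℝ} {v : V} (hv : v ∈ D.nline t) (hv0 : v ≠ 0) :
    (finBasis ℝ (𝔼 4)).det (D.eframe t v) ≠ 0 := by
  have hA := D.injective_mfderiv_e (D.curve t)
  have hspan : Submodule.span ℝ (Set.range (D.vframe t v)) ≤ D.tplane (D.curve t) := by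
    rw [Submodule.span_le]
    rintro _ ⟨k, rfl⟩
    exact D.vframe_mem t (D.nline_le t hv) k
  have hinjOn : Set.InjOn (leftInv (D.tmap (D.curve t))) (D.tplane (D.curve t)) := leftInv_injOn hA
  have h1 : LinearIndependent ℝ ((leftInv (D.tmap (D.curve t))).toLinearMap ∘ D.vframe t v) := by
    refine (D.linearIndependent_vframe hv hv0).map_injOn _ ?_
    intro a ha b hb hab
    exact hinjOn (hspan ha) (hspan hb) hab
  have h2 : D.eframe t v = ((leftInv (D.tmap (D.curve t))).toLinearMap ∘ D.vframe t v) ∘ idx := by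
    funext i
    rfl
  rw [h2]
  exact det_ne_zero_of_linearIndependent _ (h1.comp _ idx.injective)

/-- **The chart reading of the pulled-back frame.** On the domain of the chart at `p`, reading the
vector `leftInv (de_x) z` (`z ∈ T_x`) in the chart at `p` gives `leftInv (D(e ∘ φ_p⁻¹)(φ_p x)) z`:
`de_x = D(e ∘ φ_p⁻¹)(φ_p x) ∘ Dφ_p(x)` (`mfderiv_eq_chartDeriv_comp`) and `Dφ_p(x)` is the
tangent coordinate change. [folklore] -/
theorem tangentCoordChange_leftInv_tmap {p x : X} (hx : x ∈ (chartAt (𝔼 4) p).source) {z : V}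
    (hz : z ∈ D.tplane x) :
    tangentCoordChange (𝓡 4) x p x (leftInv (D.tmap x) z) =
      leftInv (chartDeriv (𝓡 4) D.e p (extChartAt (𝓡 4) p x)) z := by
  have hx' : x ∈ (extChartAt (𝓡 4) p).source := by rwa [extChartAt_source]
  have hA : D.tmap x = (chartDeriv (𝓡 4) D.e p (extChartAt (𝓡 4) p x)).comp
      (mfderiv (𝓡 4) 𝓘(ℝ, 𝔼 4) (extChartAt (𝓡 4) p) x) :=
    mfderiv_eq_chartDeriv_comp hx' (D.mdifferentiableAt_e x)
  have hfun : ⇑(extChartAt (𝓡 4) p) = ⇑(chartAt (𝔼 4) p) := by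
    rw [extChartAt_coe, modelWithCornersSelf_coe, Function.id_comp]
  have hT : mfderiv (𝓡 4) 𝓘(ℝ, 𝔼 4) (extChartAt (𝓡 4) p) x = tangentCoordChange (𝓡 4) x p x := by
    rw [hfun]
    exact mfderiv_chartAt_eq_tangentCoordChange (I := 𝓡 4) hx
  have hC : Injective (chartDeriv (𝓡 4) D.e p (extChartAt (𝓡 4) p x)) :=
    injective_chartDeriv hx' (D.mdifferentiableAt_e x) (D.injective_mfderiv_e x)
  obtain ⟨a, rfl⟩ := D.mem_tplane_iff.1 hz
  have hAa : D.tmap x a =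
      chartDeriv (𝓡 4) D.e p (extChartAt (𝓡 4) p x) (tangentCoordChange (𝓡 4) x p x a) := by
    rw [hA, ← hT]
    rfl
  rw [leftInv_apply_self (D.injective_mfderiv_e x), hAa, leftInv_apply_self hC]

omit [FiniteDimensional ℝ V] in
/-- The derivative `D(e ∘ φ_p⁻¹)` composed with `φ_p ∘ γ` is continuous on `γ ⁻¹' (domain of φ_p)`.
[folklore] -/
theorem continuousOn_chartDeriv_curve (p : X) :
    ContinuousOn (fun t => chartDeriv (𝓡 4) D.e p (extChartAt (𝓡 4) p (D.curve t)))
      (D.curve ⁻¹' (chartAt (𝔼 4) p).source) := by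
  have h1 : ContinuousOn (chartDeriv (𝓡 4) D.e p) (extChartAt (𝓡 4) p).target :=
    (contDiffOn_chartDeriv D.contMDiff_e p).continuousOn
  have h2 : ContinuousOn (fun t => extChartAt (𝓡 4) p (D.curve t))
      (D.curve ⁻¹' (chartAt (𝔼 4) p).source) := by
    refine (continuousOn_extChartAt p).comp D.continuous_curve.continuousOn fun t ht => ?_
    rwa [mem_preimage, ← extChartAt_source (𝓡 4)] at ht
  refine h1.comp h2 fun t ht => (extChartAt (𝓡 4) p).map_source ?_
  rwa [mem_preimage, ← extChartAt_source (𝓡 4)] at ht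

/-- **The pulled-back frame is continuous in charts** along any fourth vector `v t ∈ T_{γ t}`
continuous on `S`: the hypothesis of `SmoothOrientation.isPosFrame_iff_of_isPreconnected`.
[folklore] -/
theorem continuousOn_eframe_reading {S : Set ℝ} {v : ℝ → V} (hv : ContinuousOn v S)
    (hvT : ∀ t ∈ S, v t ∈ D.tplane (D.curve t)) (p : X) :
    ContinuousOn (fun t i => tangentCoordChange (𝓡 4) (D.curve t) p (D.curve t) (D.eframe t (v t) i))
      (S ∩ D.curve ⁻¹' (chartAt (𝔼 4) p).source) := by
  have heq : ∀ t ∈ S ∩ D.curve ⁻¹' (chartAt (𝔼 4) p).source,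
      (fun i => tangentCoordChange (𝓡 4) (D.curve t) p (D.curve t) (D.eframe t (v t) i)) =
        fun i => leftInv (chartDeriv (𝓡 4) D.e p (extChartAt (𝓡 4) p (D.curve t)))
          (D.vframe t (v t) (idx i)) := by
    rintro t ⟨htS, htp⟩
    funext i
    exact D.tangentCoordChange_leftInv_tmap htp (D.vframe_mem t (hvT t htS) (idx i))
  refine ContinuousOn.congr ?_ heq
  refine continuousOn_pi.2 fun i => ?_
  have hL : ContinuousOn (fun t => leftInv (chartDeriv (𝓡 4) D.e p (extChartAt (𝓡 4) p (D.curve t))))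
      (S ∩ D.curve ⁻¹' (chartAt (𝔼 4) p).source) := by
    refine ContinuousOn.mono ?_ inter_subset_right
    intro t ht
    have hx' : D.curve t ∈ (extChartAt (𝓡 4) p).source := by
      rw [extChartAt_source]; exact ht
    have hC : Injective (chartDeriv (𝓡 4) D.e p (extChartAt (𝓡 4) p (D.curve t))) :=
      injective_chartDeriv hx' (D.mdifferentiableAt_e _) (D.injective_mfderiv_e _)
    exact (contDiffAt_leftInv hC).continuousAt.comp_continuousWithinAt
      (f := fun t => chartDeriv (𝓡 4) D.e p (extChartAt (𝓡 4) p (D.curve t)))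
      (D.continuousOn_chartDeriv_curve p t ht)
  exact hL.clm_apply ((D.continuousOn_vframe hv (idx i)).mono inter_subset_left)

section Orientation

variable (o : SmoothOrientation (𝓡 4) X)

/-- **Positivity of a fourth vector.** `IsPos o t v`: the frame `(τ t, n₁ t, n₂ t, v)`, read back
in `T_{γ t} X`, is positively oriented for `o`. [folklore] -/
def IsPos (t : ℝ) (v : V) : Prop := o.IsPosFrame (D.curve t) (D.eframe t v)

/-- Positivity has period `1` in `t`. [folklore] -/
theorem isPos_add_one (t : ℝ) (v : V) : D.IsPos o (t + 1) v ↔ D.IsPos o t v := by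
  simp only [IsPos, D.eframe_add_one, D.periodic_curve t]

/-- **Reversing the fourth vector reverses positivity** (for a non-degenerate frame). [folklore] -/
theorem isPos_neg_iff {t : ℝ} {v : V} (hv : v ∈ D.nline t) (hv0 : v ≠ 0) :
    D.IsPos o t (-v) ↔ ¬D.IsPos o t v := by
  refine o.isPosFrame_iff_not_of_eq_neg (D.curve t) (D.det_eframe_ne_zero hv hv0) (idx.symm 3)
    ?_ fun j hj => ?_
  · simp [eframe]
  · have hj' : idx j ≠ 3 := fun h => hj (by rw [← h, Equiv.symm_apply_apply])
    simp only [eframe, D.vframe_apply_of_ne_three t (-v) v hj']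

/-- A unit vector spanning the line `L_t`. [folklore] -/
theorem exists_unit_mem_nline (t : ℝ) : ∃ u ∈ D.nline t, ‖u‖ = 1 := by
  have hne : D.nline t ≠ ⊥ := fun h => by
    have := D.finrank_nline t
    rw [h, finrank_bot] at this
    exact zero_ne_one this
  obtain ⟨b, hb, hb0⟩ := Submodule.exists_mem_ne_zero_of_ne_bot hne
  refine ⟨‖b‖⁻¹ • b, Submodule.smul_mem _ _ hb, ?_⟩
  rw [norm_smul, norm_inv, norm_norm, inv_mul_cancel₀ (norm_ne_zero_iff.2 hb0)]

/-- Vectors of the line `L_t` are multiples of any unit vector in it. [folklore] -/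
theorem eq_smul_of_mem_nline {t : ℝ} {u : V} (hu : u ∈ D.nline t) (hu1 : ‖u‖ = 1) {v : V}
    (hv : v ∈ D.nline t) : ∃ a : ℝ, v = a • u := by
  have hu0 : u ≠ 0 := fun h => by rw [h, norm_zero] at hu1; exact zero_ne_one hu1
  have hle : (ℝ ∙ u) ≤ D.nline t := (Submodule.span_singleton_le_iff_mem _ _).2 hu
  have heq : (ℝ ∙ u) = D.nline t :=
    Submodule.eq_of_le_of_finrank_eq hle (by rw [finrank_span_singleton hu0, D.finrank_nline])
  rw [← heq, Submodule.mem_span_singleton] at hv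
  obtain ⟨a, rfl⟩ := hv
  exact ⟨a, rfl⟩

/-- Unit vectors of the line `L_t` are `±` any given one. [folklore] -/
theorem eq_or_eq_neg_of_mem_nline {t : ℝ} {u : V} (hu : u ∈ D.nline t) (hu1 : ‖u‖ = 1) {v : V}
    (hv : v ∈ D.nline t) (hv1 : ‖v‖ = 1) : v = u ∨ v = -u := by
  obtain ⟨a, rfl⟩ := D.eq_smul_of_mem_nline hu hu1 hv
  rw [norm_smul, hu1, mul_one, Real.norm_eq_abs, abs_eq (zero_le_one)] at hv1
  rcases hv1 with h | h
  · left; rw [h, one_smul]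
  · right; rw [h, neg_one_smul]

/-- **Existence and uniqueness of the positive unit normal.** Exactly one unit vector `v ∈ L_t`
makes `(τ, n₁, n₂, v)` positively oriented (the two unit vectors give frames of opposite
character). [folklore] -/
theorem existsUnique_isPos (t : ℝ) : ∃! v : V, v ∈ D.nline t ∧ ‖v‖ = 1 ∧ D.IsPos o t v := by
  obtain ⟨u, hu, hu1⟩ := D.exists_unit_mem_nline t
  have hu0 : u ≠ 0 := fun h => by rw [h, norm_zero] at hu1; exact zero_ne_one hu1
  have key : ∀ v, v ∈ D.nline t → ‖v‖ = 1 → D.IsPos o t v → ∀ w, w ∈ D.nline t → ‖w‖ = 1 →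
      D.IsPos o t w → w = v := by
    intro v hv hv1 hvp w hw hw1 hwp
    rcases D.eq_or_eq_neg_of_mem_nline hv hv1 hw hw1 with h | h
    · exact h
    · exfalso
      rw [h] at hwp
      have hv0 : v ≠ 0 := fun h0 => by rw [h0, norm_zero] at hv1; exact zero_ne_one hv1
      exact (D.isPos_neg_iff o hv hv0).1 hwp hvp
  by_cases hpos : D.IsPos o t u
  · exact ⟨u, ⟨hu, hu1, hpos⟩, fun w hw => key u hu hu1 hpos w hw.1 hw.2.1 hw.2.2⟩
  · have hneg : D.IsPos o t (-u) := (D.isPos_neg_iff o hu hu0).2 hpos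
    refine ⟨-u, ⟨Submodule.neg_mem _ hu, by rw [norm_neg, hu1], hneg⟩, fun w hw => ?_⟩
    exact key (-u) (Submodule.neg_mem _ hu) (by rw [norm_neg, hu1]) hneg w hw.1 hw.2.1 hw.2.2

/-- The **third normal field**: the positive unit vector of the line `L_t`. [folklore] -/
def sec3 (t : ℝ) : V := (D.existsUnique_isPos o t).exists.choose

/-- `n₃ t ∈ L_t`. [folklore] -/
theorem sec3_mem (t : ℝ) : D.sec3 o t ∈ D.nline t := (D.existsUnique_isPos o t).exists.choose_spec.1

/-- `n₃` is a unit vector field. [folklore] -/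
theorem norm_sec3 (t : ℝ) : ‖D.sec3 o t‖ = 1 := (D.existsUnique_isPos o t).exists.choose_spec.2.1

/-- `(τ, n₁, n₂, n₃)` is positively oriented. [folklore] -/
theorem isPos_sec3 (t : ℝ) : D.IsPos o t (D.sec3 o t) := (D.existsUnique_isPos o t).exists.choose_spec.2.2

/-- `n₃` never vanishes. [folklore] -/
theorem sec3_ne_zero (t : ℝ) : D.sec3 o t ≠ 0 := fun h => by
  have := D.norm_sec3 o t
  rw [h, norm_zero] at this
  exact zero_ne_one this

/-- **Characterisation of `n₃ t`** by its defining property. [folklore] -/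
theorem eq_sec3 {t : ℝ} {v : V} (hv : v ∈ D.nline t) (hv1 : ‖v‖ = 1) (hpos : D.IsPos o t v) :
    v = D.sec3 o t :=
  (D.existsUnique_isPos o t).unique ⟨hv, hv1, hpos⟩ ⟨D.sec3_mem o t, D.norm_sec3 o t, D.isPos_sec3 o t⟩

/-- `n₃` lies in the tangent plane. [folklore] -/
theorem sec3_mem_tplane (t : ℝ) : D.sec3 o t ∈ D.tplane (D.curve t) := D.nline_le t (D.sec3_mem o t)

/-- `n₃` has period `1`. [folklore] -/
theorem periodic_sec3 : Periodic (D.sec3 o) 1 := by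
  intro t
  have hline : D.nline (t + 1) = D.nline t := by
    simp only [nline, D.periodic_frameMap t, D.periodic_curve t]
  symm
  refine (D.existsUnique_isPos o (t + 1)).unique ⟨?_, D.norm_sec3 o t, ?_⟩
    ⟨D.sec3_mem o (t + 1), D.norm_sec3 o (t + 1), D.isPos_sec3 o (t + 1)⟩
  · rw [hline]; exact D.sec3_mem o t
  · rw [D.isPos_add_one]; exact D.isPos_sec3 o t

/-- **`n₃` is smooth.** Near `t₀`, the normalised projection `û t` of `n₃ t₀` to `L_t` is a smooth
unit section of `L`; the frames `(τ, n₁, n₂, û)` move continuously (in charts) and are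
non-degenerate, so their orientation character is constant near `t₀`
(`SmoothOrientation.isPosFrame_iff_of_isPreconnected`), positive at `t₀`; hence `n₃ = û` near
`t₀` by uniqueness. This is the step that uses the orientation. [folklore] -/
theorem contDiff_sec3 : ContDiff ℝ ∞ (D.sec3 o) := by
  refine contDiff_iff_contDiffAt.2 fun t₀ => ?_
  set ℓ : V := D.sec3 o t₀ with hℓ
  -- the projected section and its normalisation
  set m : ℝ → V := fun t => D.lproj t ℓ with hm
  have hm_smooth : ContDiff ℝ ∞ m := D.contDiff_lproj.clm_apply contDiff_const
  have hm_mem : ∀ t, m t ∈ D.nline t := fun t => by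
    show D.lproj t ℓ ∈ D.nline t
    rw [← D.starProjection_nline t]
    exact Submodule.starProjection_apply_mem _ ℓ
  have hm0 : m t₀ = ℓ := by
    show D.lproj t₀ ℓ = ℓ
    rw [← D.starProjection_nline t₀]
    exact Submodule.starProjection_eq_self_iff.2 (D.sec3_mem o t₀)
  -- a ball on which `m ≠ 0`
  obtain ⟨δ, hδ, hball⟩ : ∃ δ > 0, ∀ t ∈ Metric.ball t₀ δ, m t ≠ 0 := by
    have hopen : IsOpen {t | m t ≠ 0} := isOpen_ne_fun hm_smooth.continuous continuous_const
    have hmem : t₀ ∈ {t | m t ≠ 0} := by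
      show m t₀ ≠ 0
      rw [hm0]; exact D.sec3_ne_zero o t₀
    obtain ⟨δ, hδ, hsub⟩ := Metric.isOpen_iff.1 hopen t₀ hmem
    exact ⟨δ, hδ, fun t ht => hsub ht⟩
  set uu : ℝ → V := fun t => ‖m t‖⁻¹ • m t with huu
  have huu_mem : ∀ t, uu t ∈ D.nline t := fun t => Submodule.smul_mem _ _ (hm_mem t)
  have huu_norm : ∀ t ∈ Metric.ball t₀ δ, ‖uu t‖ = 1 := fun t ht => by
    show ‖‖m t‖⁻¹ • m t‖ = 1
    rw [norm_smul, norm_inv, norm_norm, inv_mul_cancel₀ (norm_ne_zero_iff.2 (hball t ht))]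
  have huu_smooth : ∀ t ∈ Metric.ball t₀ δ, ContDiffAt ℝ ∞ uu t := fun t ht =>
    ((hm_smooth.contDiffAt.norm ℝ (hball t ht)).inv (norm_ne_zero_iff.2 (hball t ht))).smul
      hm_smooth.contDiffAt
  have huu0 : uu t₀ = ℓ := by
    show ‖m t₀‖⁻¹ • m t₀ = ℓ
    rw [hm0, D.norm_sec3 o t₀, inv_one, one_smul]
  -- constancy of the orientation character on the ball
  have hS : IsPreconnected (Metric.ball t₀ δ) := (convex_ball t₀ δ).isPreconnected
  have hcont : ContinuousOn uu (Metric.ball t₀ δ) := fun t ht =>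
    (huu_smooth t ht).continuousAt.continuousWithinAt
  have hconst : ∀ t ∈ Metric.ball t₀ δ, D.IsPos o t (uu t) := by
    intro t ht
    have key := o.isPosFrame_iff_of_isPreconnected hS (γ := D.curve) (B := fun t => D.eframe t (uu t))
      D.continuous_curve.continuousOn
      (D.continuousOn_eframe_reading hcont fun t _ => D.nline_le t (huu_mem t))
      (fun t ht => D.det_eframe_ne_zero (huu_mem t)
        (fun h => by have := huu_norm t ht; rw [h, norm_zero] at this; exact zero_ne_one this))
      ht (Metric.mem_ball_self hδ)
    have h0 : D.IsPos o t₀ (uu t₀) := by rw [huu0]; exact D.isPos_sec3 o t₀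
    exact key.2 h0
  -- `sec3 = uu` near `t₀`
  have heq : D.sec3 o =ᶠ[𝓝 t₀] uu := by
    filter_upwards [Metric.ball_mem_nhds t₀ hδ] with t ht
    exact (D.eq_sec3 o (huu_mem t) (huu_norm t ht) (hconst t ht)).symm
  exact (huu_smooth t₀ (Metric.mem_ball_self hδ)).congr_of_eventuallyEq heq

/-- **The full frame `(τ, n₁, n₂, n₃)` is linearly independent.** [folklore] -/
theorem linearIndependent_fullFrame (t : ℝ) : LinearIndependent ℝ (D.vframe t (D.sec3 o t)) :=
  D.linearIndependent_vframe (D.sec3_mem o t) (D.sec3_ne_zero o t)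

end Orientation

/-! #### Descent to the circle -/

section Descent

variable (o : SmoothOrientation (𝓡 4) X)

/-- The **three normal fields** `n₁, n₂, n₃` along the `1`-periodic curve. [folklore] -/
def nsec (i : Fin 3) (t : ℝ) : V := ![D.sec1 t, D.sec2 t, D.sec3 o t] i

/-- The normal fields are smooth. [folklore] -/
theorem contDiff_nsec (i : Fin 3) : ContDiff ℝ ∞ (D.nsec o i) := by
  fin_cases i
  · exact D.contDiff_sec1
  · exact D.contDiff_sec2
  · exact D.contDiff_sec3 o

/-- The normal fields have period `1`. [folklore] -/
theorem periodic_nsec (i : Fin 3) : Periodic (D.nsec o i) 1 := by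
  fin_cases i
  · exact D.periodic_sec1
  · exact D.periodic_sec2
  · exact D.periodic_sec3 o

/-- The normal fields only depend on the point of the circle. [folklore] -/
theorem nsec_eq_of_circlePt_eq (i : Fin 3) {s t : ℝ} (h : circlePt s = circlePt t) :
    D.nsec o i s = D.nsec o i t := by
  obtain ⟨m, rfl⟩ := circlePt_eq_circlePt_iff.1 h
  have := (D.periodic_nsec o i).int_mul m t
  rwa [mul_one] at this

/-- The normal fields are tangent vectors. [folklore] -/
theorem nsec_mem_tplane (i : Fin 3) (t : ℝ) : D.nsec o i t ∈ D.tplane (D.curve t) := by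
  fin_cases i
  · exact D.nplane_le t (D.sec1_mem t)
  · exact D.nplane_le t (D.sec2_mem t)
  · exact D.sec3_mem_tplane o t

/-- `τ, n₁, n₂, n₃` are linearly independent, in the indexing `vframe t (n₃ t)`. [folklore] -/
theorem vframe_sec3_eq (t : ℝ) (k : Fin 4) :
    D.vframe t (D.sec3 o t) k = ![D.vel t, D.nsec o 0 t, D.nsec o 1 t, D.nsec o 2 t] k := by
  fin_cases k <;> rfl

/-- The **normal fields on the circle**: `nfield i u = nᵢ (angA u)`, i.e. `nᵢ` descended along
the covering `circlePt` (well defined by periodicity). [folklore] -/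
def nfield (i : Fin 3) (u : 𝕊 1) : V := D.nsec o i (angA u)

/-- The descended fields pull back to the fields along the curve. [folklore] -/
theorem nfield_circlePt (i : Fin 3) (t : ℝ) : D.nfield o i (circlePt t) = D.nsec o i t :=
  D.nsec_eq_of_circlePt_eq o i (circlePt_angA _)

/-- Alternative formula through the second angle function. [folklore] -/
theorem nfield_eq_nsec_angB (i : Fin 3) (u : 𝕊 1) : D.nfield o i u = D.nsec o i (angB u) :=
  D.nsec_eq_of_circlePt_eq o i (by rw [circlePt_angA, circlePt_angB])

/-- **The descended normal fields are smooth on the circle** (locally they factor through the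
smooth angle functions `angA`, `angB`). [folklore] -/
theorem contMDiff_nfield (i : Fin 3) : ContMDiff (𝓡 1) 𝓘(ℝ, V) ∞ (D.nfield o i) := by
  intro u
  by_cases hu : u = ptA
  · have hB : u ≠ ptB := fun h => ptA_ne_ptB (hu.symm.trans h)
    have heq : D.nfield o i = fun u => D.nsec o i (angB u) := funext (D.nfield_eq_nsec_angB o i)
    rw [heq]
    exact ((D.contDiff_nsec o i).contMDiff.contMDiffAt).comp u (contMDiffAt_angB hB)
  · exact ((D.contDiff_nsec o i).contMDiff.contMDiffAt).comp u (contMDiffAt_angA hu)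

/-- The descended fields are tangent vectors at `c u`. [folklore] -/
theorem nfield_mem_tplane (i : Fin 3) (u : 𝕊 1) : D.nfield o i u ∈ D.tplane (D.c u) := by
  have h := D.nsec_mem_tplane o i (angA u)
  rwa [curve, circlePt_angA] at h

/-- The **normal frame on the circle as linear maps `ℝ³ → V`**. [folklore] -/
def nframeMap (u : 𝕊 1) : 𝔼 3 →L[ℝ] V := frameOfL fun i => D.nfield o i u

/-- Unfolding of `nframeMap`. [folklore] -/
theorem nframeMap_apply (u : 𝕊 1) (a : 𝔼 3) : D.nframeMap o u a = ∑ i : Fin 3, a i • D.nfield o i u :=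
  frameOfL_apply _ a

/-- `nframeMap` is smooth on the circle. [folklore] -/
theorem contMDiff_nframeMap : ContMDiff (𝓡 1) 𝓘(ℝ, 𝔼 3 →L[ℝ] V) ∞ (D.nframeMap o) :=
  (frameOfL : (Fin 3 → V) →L[ℝ] (𝔼 3 →L[ℝ] V)).contMDiff.comp
    (contMDiff_pi_space.2 fun i => D.contMDiff_nfield o i)

/-- Values of `nframeMap u` are tangent vectors at `c u`. [folklore] -/
theorem nframeMap_apply_mem (u : 𝕊 1) (a : 𝔼 3) : D.nframeMap o u a ∈ D.tplane (D.c u) := by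
  rw [nframeMap_apply]
  exact Submodule.sum_mem _ fun i _ => Submodule.smul_mem _ _ (D.nfield_mem_tplane o i u)

/-! #### The normal framing -/

/-- **The normal framing** `N u = (de_{c u})⁻¹ ∘ (n₁, n₂, n₃) : ℝ³ →L T_{c u} X`. [folklore] -/
def framing (u : 𝕊 1) : 𝔼 3 →L[ℝ] 𝔼 4 := (leftInv (D.tmap (D.c u))).comp (D.nframeMap o u)

/-- **The framing is smooth along `c`** (`IsSmoothAlong`): read in the chart at `p` it is
`leftInv (D(e ∘ φ_p⁻¹)(φ_p (c u))) ∘ nframeMap u`, a smooth function of `u`. [folklore] -/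
theorem isSmoothAlong_framing : IsSmoothAlong (𝓡 1) D.c (D.framing o) := by
  intro p
  have heq : ∀ u ∈ D.c ⁻¹' (chartAt (𝔼 4) p).source, frameIn D.c (D.framing o) p u =
      (leftInv (chartDeriv (𝓡 4) D.e p (extChartAt (𝓡 4) p (D.c u)))).comp (D.nframeMap o u) := by
    intro u hu
    refine ContinuousLinearMap.ext fun a => ?_
    simp only [frameIn, framing, ContinuousLinearMap.coe_comp, Function.comp_apply]
    exact D.tangentCoordChange_leftInv_tmap hu (D.nframeMap_apply_mem o u a)
  refine ContMDiffOn.congr ?_ heq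
  refine ContMDiffOn.clm_comp ?_ (D.contMDiff_nframeMap o).contMDiffOn
  intro u hu
  have hx' : D.c u ∈ (extChartAt (𝓡 4) p).source := by rw [extChartAt_source]; exact hu
  have hC : Injective (chartDeriv (𝓡 4) D.e p (extChartAt (𝓡 4) p (D.c u))) :=
    injective_chartDeriv hx' (D.mdifferentiableAt_e _) (D.injective_mfderiv_e _)
  have h1 : ContMDiffOn (𝓡 1) 𝓘(ℝ, 𝔼 4) ∞ (fun u => extChartAt (𝓡 4) p (D.c u))
      (D.c ⁻¹' (chartAt (𝔼 4) p).source) := by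
    refine (contMDiffOn_extChartAt (I := 𝓡 4) (n := ∞) (x := p)).comp D.contMDiff_c.contMDiffOn ?_
    intro v hv
    exact hv
  have h2 : ContMDiffOn (𝓡 1) 𝓘(ℝ, 𝔼 4 →L[ℝ] V) ∞
      (fun u => chartDeriv (𝓡 4) D.e p (extChartAt (𝓡 4) p (D.c u))) (D.c ⁻¹' (chartAt (𝔼 4) p).source) := by
    refine (contDiffOn_chartDeriv D.contMDiff_e p).contMDiffOn.comp h1 fun v hv => ?_
    exact (extChartAt (𝓡 4) p).map_source (by rw [extChartAt_source]; exact hv)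
  exact (contDiffAt_leftInv hC).contMDiffAt.comp_contMDiffWithinAt u (h2 u hu)

/-- The differential of `circlePt` is onto the tangent line of the circle. [folklore] -/
theorem surjective_mfderiv_circlePt (t : ℝ) : Surjective (mfderiv 𝓘(ℝ, ℝ) (𝓡 1) circlePt t) := by
  have h : finrank ℝ ℝ = finrank ℝ (𝔼 1) := by simp
  exact (LinearMap.injective_iff_surjective_of_finrank_eq_finrank h
    (f := (mfderiv 𝓘(ℝ, ℝ) (𝓡 1) circlePt t).toLinearMap)).1 (mfderiv_circlePt_injective t)

omit [IsManifold (𝓡 4) ∞ X] [FiniteDimensional ℝ V] in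
/-- `de ∘ dc` applied to `d(circlePt)_t r` is `r • τ t`. [folklore] -/
theorem tmap_mfderiv_c_apply (t : ℝ) (r : ℝ) :
    D.tmap (D.c (circlePt t)) (mfderiv (𝓡 1) (𝓡 4) D.c (circlePt t)
      (mfderiv 𝓘(ℝ, ℝ) (𝓡 1) circlePt t r)) = r • D.vel t := by
  have hc : MDifferentiableAt (𝓡 1) (𝓡 4) D.c (circlePt t) :=
    D.contMDiff_c.contMDiffAt.mdifferentiableAt (by simp)
  have hp : MDifferentiableAt 𝓘(ℝ, ℝ) (𝓡 1) circlePt t :=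
    contMDiff_circlePt.contMDiffAt.mdifferentiableAt (by simp)
  have he : MDifferentiableAt (𝓡 4) 𝓘(ℝ, V) D.e (D.c (circlePt t)) := D.mdifferentiableAt_e _
  have h1 : mfderiv 𝓘(ℝ, ℝ) 𝓘(ℝ, V) D.pos t = (D.tmap (D.c (circlePt t))).comp
      ((mfderiv (𝓡 1) (𝓡 4) D.c (circlePt t)).comp (mfderiv 𝓘(ℝ, ℝ) (𝓡 1) circlePt t)) := by
    rw [show D.pos = D.e ∘ (D.c ∘ circlePt) from rfl, mfderiv_comp t he (hc.comp t hp),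
      mfderiv_comp t hc hp]
    rfl
  have h2 : (fderiv ℝ D.pos t : ℝ → V) r = r • D.vel t := fderiv_eq_smul_deriv r
  rw [← h2, ← mfderiv_eq_fderiv, h1]
  rfl

/-- `de` applied to the framing gives back the normal frame: `de (N u b) = ∑ bᵢ nᵢ(u)`. [folklore] -/
theorem tmap_framing_apply (u : 𝕊 1) (b : 𝔼 3) : D.tmap (D.c u) (D.framing o u b) = D.nframeMap o u b :=
  apply_leftInv_of_mem_range (D.injective_mfderiv_e (D.c u)) (D.nframeMap_apply_mem o u b)

/-- **The framing is a normal framing**: `(dc_u) ⊕ N u : T_u 𝕊¹ × ℝ³ → T_{c u} X` is bijective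
(apply `de`: the image is spanned by `τ, n₁, n₂, n₃`, which are linearly independent, and the
dimensions agree). [folklore] -/
theorem bijective_coprod (u : 𝕊 1) :
    Bijective ((mfderiv (𝓡 1) (𝓡 4) D.c u).coprod (D.framing o u)) := by
  -- write `u = circlePt t`
  obtain ⟨t, rfl⟩ : ∃ t, circlePt t = u := ⟨angA u, circlePt_angA u⟩
  set L := (mfderiv (𝓡 1) (𝓡 4) D.c (circlePt t)).coprod (D.framing o (circlePt t)) with hL
  -- the key computation: coefficients vanish by linear independence of `τ, n₁, n₂, n₃`
  have key : ∀ (r : ℝ) (b : 𝔼 3), L (mfderiv 𝓘(ℝ, ℝ) (𝓡 1) circlePt t r, b) = 0 → r = 0 ∧ b = 0 := by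
    intro r b hab
    have h1 : r • D.vel t + D.nframeMap o (circlePt t) b = 0 := by
      rw [hL] at hab
      have h0 := congrArg (D.tmap (D.c (circlePt t))) hab
      have e1 : D.tmap (D.c (circlePt t)) (((mfderiv (𝓡 1) (𝓡 4) D.c (circlePt t)).coprod
          (D.framing o (circlePt t))) (mfderiv 𝓘(ℝ, ℝ) (𝓡 1) circlePt t r, b)) =
          D.tmap (D.c (circlePt t)) (mfderiv (𝓡 1) (𝓡 4) D.c (circlePt t)
            (mfderiv 𝓘(ℝ, ℝ) (𝓡 1) circlePt t r)) +
          D.tmap (D.c (circlePt t)) (D.framing o (circlePt t) b) :=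
        (D.tmap (D.c (circlePt t))).map_add _ _
      have e0 : D.tmap (D.c (circlePt t)) (0 : TangentSpace (𝓡 4) (D.c (circlePt t))) = 0 :=
        map_zero _
      rw [e1, e0, D.tmap_mfderiv_c_apply, D.tmap_framing_apply] at h0
      exact h0
    rw [nframeMap_apply, Fin.sum_univ_three] at h1
    simp only [nfield_circlePt] at h1
    have hind := Fintype.linearIndependent_iff.1 (D.linearIndependent_fullFrame o t)
      ![r, b 0, b 1, b 2] (by
        simp only [Fin.sum_univ_four, Matrix.cons_val_zero, Matrix.cons_val_one, Matrix.cons_val,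
          D.vframe_sec3_eq]
        simpa only [nsec, Matrix.cons_val_zero, Matrix.cons_val_one, Matrix.cons_val, add_assoc]
          using h1)
    refine ⟨hind 0, ?_⟩
    ext i
    fin_cases i
    · exact hind 1
    · exact hind 2
    · exact hind 3
  -- injectivity
  have hinj : Injective L := by
    refine (injective_iff_map_eq_zero L).2 fun ab hab => ?_
    obtain ⟨a, b⟩ := ab
    obtain ⟨r, rfl⟩ := surjective_mfderiv_circlePt t a
    obtain ⟨hr, hb⟩ := key r b hab
    subst hr hb
    exact Prod.ext (map_zero _) rfl
  -- dimension count
  refine ⟨hinj, ?_⟩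
  have hdim : finrank ℝ (𝔼 1 × 𝔼 3) = finrank ℝ (𝔼 4) := by simp
  exact (LinearMap.injective_iff_surjective_of_finrank_eq_finrank hdim (f := L.toLinearMap)).1 hinj

end Descent

end CircleSetup

/-! ### The main results -/

/-- **Normal framings of embedded circles in compact orientable 4-manifolds** — the compact case
of `exists_normalFraming_of_isOrientable`: a `C^∞` embedding `c : 𝕊¹ → X` into a compact
orientable `C^∞` 4-manifold admits linear maps `N u : ℝ³ →L T_{c u} X`, smooth along `c`, with
`(dc_u) ⊕ N u` bijective. Embed `X ⊆ V = ℝⁿ` (Whitney), take two normal fields in general position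
and the third from the orientation (`CircleSetup.framing`) (Hirsch, *Differential Topology*
(1976), Ch. 4 §4, Lemma 4.1 and Exercise 2: orientable bundles over `S¹` are trivial; Kosinski,
*Differential Manifolds* (1993), VI.6). [folklore] -/
theorem exists_normalFraming_of_compactSpace {X : Type u} [TopologicalSpace X] [T2Space X]
    [CompactSpace X] [ChartedSpace (𝔼 4) X] [IsManifold (𝓡 4) ∞ X] (hX : IsOrientable (𝓡 4) X)
    (c : 𝕊 1 → X) (hc : Manifold.IsSmoothEmbedding (𝓡 1) (𝓡 4) ∞ c) :
    ∃ N : 𝕊 1 → (𝔼 3 →L[ℝ] 𝔼 4), IsSmoothAlong (𝓡 1) c N ∧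
      ∀ u : 𝕊 1, Bijective ((mfderiv (𝓡 1) (𝓡 4) c u).coprod (N u)) := by
  obtain ⟨o⟩ := hX
  obtain ⟨n, e, he, -, hinj⟩ := exists_embedding_euclidean_of_compact (I := 𝓡 4) (M := X)
  let D : CircleSetup X (𝔼 n) := ⟨e, c, he, hinj, hc⟩
  exact ⟨D.framing o, D.isSmoothAlong_framing o, D.bijective_coprod o⟩

/-- **Tubular neighbourhoods of circles in compact orientable 4-manifolds** — the compact case of
the named fact `Literature.Topology.FourManifolds.nonempty_circleNbhd`: a smoothly embedded circle
in a compact orientable `C^∞` 4-manifold has an open tubular neighbourhood `𝕊¹ × ℝ³ ↪ X`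
(`CircleNbhd`), by `exists_normalFraming_of_compactSpace` and the tubular neighbourhood theorem
for framed circles `nonempty_circleNbhd_of_isSmoothAlong` (Kosinski, *Differential Manifolds*
(1993), III Cor. 2.3 with VI.6; Gompf–Stipsicz (1999), §5.2). [folklore] -/
theorem nonempty_circleNbhd_of_compactSpace {X : Type u} [TopologicalSpace X] [T2Space X]
    [CompactSpace X] [ChartedSpace (𝔼 4) X] [IsManifold (𝓡 4) ∞ X] (hX : IsOrientable (𝓡 4) X)
    (c : 𝕊 1 → X) (hc : Manifold.IsSmoothEmbedding (𝓡 1) (𝓡 4) ∞ c) :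
    Nonempty (CircleNbhd (𝓡 4) c) := by
  obtain ⟨N, hN, hbij⟩ := exists_normalFraming_of_compactSpace hX c hc
  exact nonempty_circleNbhd_of_isSmoothAlong hc hN hbij

end Literature.Topology.FourManifolds
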